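import Mathlib
import HarnessLib

/-!
# Item `LrcModEntire` (stmt-NavierStokesRegularity-20428) — (Q4) entrance input: STRICT CONCAVITY OF THE CROSS-SECTIONS ON THE THIN TUBE from the non-degeneracy at the hot points

ns-k2-port-2 g5 (helper prover under the LEAD of item 20428, ns-poloidal-K2-p3 g14; `--supports stmt-NavierStokesRegularity-20428 --as helper`).
The `hconc` input of `…LrcModEntireRidgeWebFermat.web_fermat` (`D²(F τ)(Γ s + nν s + z e₂)(ν s)(ν s) < 0` for `|n| < r`, `|τ|, |z| < δ`) from three uniform constants:
the non-degeneracy AT the hot points at `τ = 0` (`D²(F 0)(Γ s)(ν s)(ν s) ≤ −κ₀`, the re-entry package of `…RidgeHullIterate` / `…RidgeHullValues`), a spatial bound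
`‖D³(F τ)‖ ≤ C₃` (KNSS slice bound, every `τ` in the window) and a temporal modulus `|D²(F τ)(y)(ν,ν) − D²(F 0)(y)(ν,ν)| ≤ C_t|τ|` (`‖ν‖ ≤ 1`), on the thin tube
`C₃(r + δ) + C_t δ < κ₀`.  Class-free:

* `abs_hessian_sub_le_of_norm_iteratedFDeriv_three` — `‖D³f‖ ≤ C₃` ⇒ `|D²f(y)(u,w) − D²f(y′)(u,w)| ≤ C₃‖y − y′‖‖u‖‖w‖` (mean value inequality for `iteratedFDeriv ℝ 2 f`);
* `hessian_neg_on_tube` — the `hconc` of `web_fermat`.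

WHAT THIS IS NOT: not a claim about Navier–Stokes regularity — an inequality for the entrance of the research cell (Q4) on hypothetical profiles (bears_on LADDER-NS N0, item 20428 / crux 19708;
20428/19708/27893 OPEN).  No summit statement is proved here.
-/

noncomputable section

-- the summit and its single sub-problem share the name (CONVENTIONS §1), as in every Theorems file
set_option linter.dupNamespace false

namespace Summit.NavierStokesRegularity.NavierStokesRegularity.Theorems.PoloidalWindowDoorLrcModEntireRidgeConcavityTube

open Set Filter Topology Metric Function

variable {E : Type*} [NormedAddCommGroup E] [NormedSpace ℝ E]

/-- **The Hessian is `C₃`-Lipschitz when `‖D³f‖ ≤ C₃`**: `|D²f(y)(u,w) − D²f(y′)(u,w)| ≤ C₃‖y − y′‖‖u‖‖w‖` (`f` of class `C³`). [folklore] -/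
theorem abs_hessian_sub_le_of_norm_iteratedFDeriv_three {f : E → ℝ} (hf : ContDiff ℝ 3 f) {C₃ : ℝ} (hC : ∀ x, ‖iteratedFDeriv ℝ 3 f x‖ ≤ C₃)
    (y y' u w : E) : |fderiv ℝ (fderiv ℝ f) y u w - fderiv ℝ (fderiv ℝ f) y' u w| ≤ C₃ * ‖y - y'‖ * ‖u‖ * ‖w‖ := by
  -- `iteratedFDeriv ℝ 2 f` is differentiable with derivative of norm `‖iteratedFDeriv ℝ 3 f‖ ≤ C₃`
  have hd : ∀ x, DifferentiableAt ℝ (iteratedFDeriv ℝ 2 f) x := fun x =>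
    (hf.differentiable_iteratedFDeriv (by norm_cast) : Differentiable ℝ (iteratedFDeriv ℝ 2 f)) x
  have hmv : ‖iteratedFDeriv ℝ 2 f y - iteratedFDeriv ℝ 2 f y'‖ ≤ C₃ * ‖y - y'‖ :=
    (convex_univ).norm_image_sub_le_of_norm_fderiv_le (fun x _ => hd x)
      (fun x _ => by rw [norm_fderiv_iteratedFDeriv]; exact hC x) (mem_univ y') (mem_univ y)
  have h : fderiv ℝ (fderiv ℝ f) y u w - fderiv ℝ (fderiv ℝ f) y' u w = (iteratedFDeriv ℝ 2 f y - iteratedFDeriv ℝ 2 f y') ![u, w] := by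
    rw [sub_apply, iteratedFDeriv_two_apply, iteratedFDeriv_two_apply]
    rfl
  rw [h, ← Real.norm_eq_abs]
  refine (ContinuousMultilinearMap.le_opNorm _ _).trans ?_
  rw [Fin.prod_univ_two]
  simp only [Matrix.cons_val_zero, Matrix.cons_val_one]
  calc ‖iteratedFDeriv ℝ 2 f y - iteratedFDeriv ℝ 2 f y'‖ * (‖u‖ * ‖w‖) ≤ C₃ * ‖y - y'‖ * (‖u‖ * ‖w‖) :=
        mul_le_mul_of_nonneg_right hmv (by positivity)
    _ = C₃ * ‖y - y'‖ * ‖u‖ * ‖w‖ := by ring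

/-- **The cross-sections are strictly concave on the thin tube.**  `F : ℝ → E → ℝ` with `C³` slices in the window, `‖D³(F τ)‖ ≤ C₃`, a temporal modulus
`|D²(F τ)(y)(ν s)(ν s) − D²(F 0)(y)(ν s)(ν s)| ≤ C_t|τ|`, unit normals `‖ν s‖ ≤ 1`, and the non-degeneracy at the centres `D²(F 0)(Γ s)(ν s)(ν s) ≤ −κ₀`; if
`C₃ (r + δ) + C_t δ < κ₀` (thin tube, small window; `‖e‖ ≤ 1` for the vertical direction) then `D²(F τ)(Γ s + n•ν s + z•e)(ν s)(ν s) < 0` for all `s`, `|n| < r`,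
`|τ|, |z| < δ` — the `hconc` of `…RidgeWebFermat.web_fermat`. [folklore] -/
theorem hessian_neg_on_tube {F : ℝ → E → ℝ} {Γ ν : ℝ → E} {e : E} {δ r κ₀ C₃ Ct : ℝ}
    (hF3 : ∀ τ, |τ| < δ → ContDiff ℝ 3 (F τ)) (hC₃ : ∀ τ, |τ| < δ → ∀ x, ‖iteratedFDeriv ℝ 3 (F τ) x‖ ≤ C₃)
    (htime : ∀ τ, |τ| < δ → ∀ y s, |fderiv ℝ (fderiv ℝ (F τ)) y (ν s) (ν s) - fderiv ℝ (fderiv ℝ (F 0)) y (ν s) (ν s)| ≤ Ct * |τ|)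
    (hν : ∀ s, ‖ν s‖ ≤ 1) (he : ‖e‖ ≤ 1) (hκ : ∀ s, fderiv ℝ (fderiv ℝ (F 0)) (Γ s) (ν s) (ν s) ≤ -κ₀)
    (hC0 : 0 ≤ C₃) (hCt : 0 ≤ Ct) (hδ : 0 < δ) (hthin : C₃ * (r + δ) + Ct * δ < κ₀)
    {τ z : ℝ} (hτ : |τ| < δ) (hz : |z| < δ) (s : ℝ) {n : ℝ} (hn : n ∈ Ioo (-r) r) :
    fderiv ℝ (fderiv ℝ (F τ)) (Γ s + n • ν s + z • e) (ν s) (ν s) < 0 := by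
  have h0 : |(0 : ℝ)| < δ := by simpa using hδ
  -- spatial step at time `0`: from the centre `Γ s` to the tube point
  set y : E := Γ s + n • ν s + z • e with hy
  have hdist : ‖y - Γ s‖ ≤ |n| + |z| := by
    have e1 : y - Γ s = n • ν s + z • e := by rw [hy]; abel
    rw [e1]
    calc ‖n • ν s + z • e‖ ≤ ‖n • ν s‖ + ‖z • e‖ := norm_add_le _ _
      _ = |n| * ‖ν s‖ + |z| * ‖e‖ := by rw [norm_smul, norm_smul, Real.norm_eq_abs, Real.norm_eq_abs]
      _ ≤ |n| * 1 + |z| * 1 := add_le_add (mul_le_mul_of_nonneg_left (hν s) (abs_nonneg n)) (mul_le_mul_of_nonneg_left he (abs_nonneg z))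
      _ = |n| + |z| := by ring
  have hsp := abs_hessian_sub_le_of_norm_iteratedFDeriv_three (hF3 0 h0) (hC₃ 0 h0) y (Γ s) (ν s) (ν s)
  have hsp' : |fderiv ℝ (fderiv ℝ (F 0)) y (ν s) (ν s) - fderiv ℝ (fderiv ℝ (F 0)) (Γ s) (ν s) (ν s)| ≤ C₃ * (|n| + |z|) := by
    refine hsp.trans ?_
    have a1 : C₃ * ‖y - Γ s‖ ≤ C₃ * (|n| + |z|) := mul_le_mul_of_nonneg_left hdist hC0
    have a2 : C₃ * ‖y - Γ s‖ * ‖ν s‖ ≤ C₃ * (|n| + |z|) * 1 := mul_le_mul a1 (hν s) (norm_nonneg _) (by positivity)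
    have a3 : C₃ * ‖y - Γ s‖ * ‖ν s‖ * ‖ν s‖ ≤ C₃ * (|n| + |z|) * 1 * 1 := mul_le_mul a2 (hν s) (norm_nonneg _) (by positivity)
    linarith
  -- temporal step
  have ht := htime τ hτ y s
  -- combine
  have hnr : |n| < r := abs_lt.2 ⟨hn.1, hn.2⟩
  have h1 := (abs_le.1 hsp').2
  have h2 := (abs_le.1 ht).2
  have hκs := hκ s
  have hbound : C₃ * (|n| + |z|) + Ct * |τ| < κ₀ := by
    have : C₃ * (|n| + |z|) + Ct * |τ| ≤ C₃ * (r + δ) + Ct * δ := by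
      gcongr
    linarith
  linarith

end Summit.NavierStokesRegularity.NavierStokesRegularity.Theorems.PoloidalWindowDoorLrcModEntireRidgeConcavityTube

end
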